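import Mathlib
import Literature.Computability.AlgebraicComplexity.StandardFamilies
import Literature.LinearAlgebra.Matrix.PermanentSubperm
import Literature.LinearAlgebra.Matrix.PermanentLaplace
import Summits.ValiantsHypothesis.ValiantsHypothesis.Theorems.SchenstedIndexPowTraceCertificateTools
import HarnessLib

/-!
# Crux `FreeSubtorus.OrbitDimensionBound` (stmt-ValiantsHypothesis-16133), registered line
`Cruxes/OrbitDimensionBound/Lines/affine_multiple.lean`, stub 2 `stub_absorbingSacrifice` —
branch (β) "always pin": the PIN ALGEBRA (helper; the stub stays OPEN)

Stub 2 of the line (L, load-bearing; the line's other two stubs are landed: `…StubCofactorShape`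
p567288, `…StubPerInvariantTorusBound` p570355) replaces the floor's pair sacrifice
(`FreeSubtorusSubtorusCovering.stub_substPer`: free `n' × n'` block kept, mixed blocks killed,
IDENTITY on the sacrificed block, `per_{n'+s} ↦ per_{n'}`) by an ABSORBING one: generic NON-ZERO
constants `t_j` on the sacrificed diagonal and, in the rigid configuration of the card's case (c) /
branch (β) of `HOME/lmr/NOTE-p8g8-AffineMultiple-stubs.md`, ONE more generic constant `u₀` PINNED at a
position `p₀ ∈ supp q` that the substitution would otherwise kill (a sacrificed row × free column, a
free row × sacrificed column, or an off-diagonal position of the sacrificed block), so that the linear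
cofactor `q` of the represented multiple `per_n · q` is mapped to a NON-ZERO CONSTANT while `per_n`
still goes to `(∏ t) · per_{n'}` ("the cofactor of `u₀` has a zero column / row").

This file proves exactly that algebra, in the floor's vocabulary (`Fin.castAdd` = free indices,
`Fin.natAdd` = sacrificed indices, `finSumFinEquiv`, `Matrix.fromBlocks`), and nothing about lifts:

* `permanent_eq_prod_diag_of_offDiag_col` / `_row` — over any commutative ring: if the off-diagonal
  support of `M` lies inside ONE column (resp. one row), `per M = ∏ M i i` (a non-identity
  permutation moves a point outside that column);
* `aeval_perPoly_absorbing_col` — ABSORBING SACRIFICE ON `per`, column form: free block kept,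
  sacrificed-rows × free-columns block zero, free-rows × sacrificed-columns block ARBITRARY (pins there
  are free of charge: `Matrix.permanent_fromBlocks_zero₂₁`), sacrificed block = `diag t` plus arbitrary
  entries in ONE of its columns ⇒ `aeval g per_{n'+s} = C (∏ t) * per_{n'}`;
  `aeval_perPoly_absorbing_row` — the transpose twin (sacrificed-rows × free-columns arbitrary, one
  arbitrary ROW in the sacrificed block); `aeval_perPoly_absorbing_diag` — no pin in the sacrificed
  block, both statements' common special case with the mixed block still arbitrary;
* `aeval_eq_C_eval_of_vars` — a polynomial all of whose variables go to constants goes to the constant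
  `C (eval c q)`; `exists_pin_eval_ne_zero` — for a LINEAR FORM `q` and `p₀` with
  `coeff x_{p₀} q ≠ 0`, some NON-ZERO pin value `u₀ ∈ {1, 2}` at `p₀` makes `eval ≠ 0` (the value is
  affine in `u₀` with slope `coeff x_{p₀} q`); `exists_pin_aeval_eq_C_ne_zero` — both combined: the
  pinned substitution sends `q` to `C κ`, `κ ≠ 0`.

Honest framing: branch (β) plumbing for stub 2 of a registered line; `stub_absorbingSacrifice`, the
crux `OrbitDimensionBound` and route FreeSubtorus stay OPEN (the LIFT half of (β) — which free-block
torus elements extend to `T_Λ`-lifts commuting with the pinned substitution — is not here);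
census-neutral; `VP ≠ VNP` is NOT proved and nothing here is progress on it.

References: the line file `Cruxes/OrbitDimensionBound/Lines/affine_multiple.lean` (stub 2, cases
(a)–(c)); [cite: LandsbergRessayre2017, Thm. 2.8, §6] (equivariant determinantal representations of
the permanent; the pair sacrifice); Minc, *Permanents* (1978), §1.2 (block-triangular permanents).
-/

set_option linter.dupNamespace false

noncomputable section

namespace Summit.ValiantsHypothesis.ValiantsHypothesis.Theorems.FreeSubtorusOrbitDimensionBound.AbsorbingSacrifice

open Literature.Computability.AlgebraicComplexity MvPolynomial

/-! ### Permanents with off-diagonal support in one column / one row -/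

section Permanent

variable {ι : Type*} [Fintype ι] [DecidableEq ι] {R : Type*} [CommRing R]

/-- If every off-diagonal entry of `M` outside the column `j₁` vanishes, then `per M = ∏ M i i`:
a permutation `σ ≠ 1` moves at least two points, hence some `i ≠ j₁`, and the factor `M (σ i) i`
of its term is an off-diagonal entry in column `i ≠ j₁`. [folklore] -/
theorem permanent_eq_prod_diag_of_offDiag_col (M : Matrix ι ι R) (j₁ : ι)
    (h : ∀ i j, i ≠ j → j ≠ j₁ → M i j = 0) : M.permanent = ∏ i, M i i := by
  unfold Matrix.permanent
  rw [Finset.sum_eq_single (1 : Equiv.Perm ι)]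
  · simp
  · intro σ _ hσ
    -- some point outside the column `j₁` is moved by `σ`
    obtain ⟨i, hi, hij⟩ : ∃ i, σ i ≠ i ∧ i ≠ j₁ := by
      by_contra hcon
      push Not at hcon
      apply hσ
      ext i
      by_cases hi : i = j₁
      · subst hi
        by_contra hne
        -- `a := σ i ≠ i` is then a fixed point, contradicting injectivity
        have ha : σ (σ i) = σ i := by
          by_contra h'
          exact (hcon (σ i) h' ▸ hne) rfl
        exact hne (σ.injective ha)
      · simpa using (fun h' => hi (hcon i h')) -- `σ i = i`
    exact Finset.prod_eq_zero (Finset.mem_univ i) (h _ _ hi hij)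
  · exact fun h => absurd (Finset.mem_univ _) h

/-- Row version: if every off-diagonal entry of `M` outside the row `i₁` vanishes, then
`per M = ∏ M i i` (transpose of the column version). [folklore] -/
theorem permanent_eq_prod_diag_of_offDiag_row (M : Matrix ι ι R) (i₁ : ι)
    (h : ∀ i j, i ≠ j → i ≠ i₁ → M i j = 0) : M.permanent = ∏ i, M i i := by
  rw [← Matrix.permanent_transpose]
  exact permanent_eq_prod_diag_of_offDiag_col M.transpose i₁
    (fun i j hij hj => h j i (Ne.symm hij) hj)

end Permanent

/-! ### The absorbing sacrifice on the generic permanent -/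

section Sacrifice

variable (n' s : ℕ) (g : Fin (n' + s) × Fin (n' + s) → MvPolynomial (Fin n' × Fin n') ℂ)
  (t : Fin s → ℂ)

/-- The substituted generic permanent is the permanent of the substituted matrix. [folklore] -/
theorem aeval_perPoly_eq_permanent :
    MvPolynomial.aeval g (perPoly (Fin (n' + s)) ℂ) = (Matrix.of fun i j => g (i, j)).permanent := by
  simp [perPoly, Matrix.permanent, map_sum, map_prod]

/-- **Absorbing sacrifice, column form.**  Free block kept (`x_{(k,l)} ↦ x_{(k,l)}`), sacrificed
rows × free columns killed, free rows × sacrificed columns ARBITRARY, sacrificed block = non-zero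
diagonal constants `t_j` plus arbitrary entries in the single column `j₁`: then
`aeval g per_{n'+s} = C (∏ t) · per_{n'}`.  (Re-indexed by `finSumFinEquiv` the substituted matrix
is `(X B; 0 D)` with `per D = ∏ t`.) [cite: LandsbergRessayre2017, §6] -/
theorem aeval_perPoly_absorbing_col (j₁ : Fin s)
    (h₁₁ : ∀ k l, g (Fin.castAdd s k, Fin.castAdd s l) = X (k, l))
    (h₂₁ : ∀ j l, g (Fin.natAdd n' j, Fin.castAdd s l) = 0)
    (hdiag : ∀ j, g (Fin.natAdd n' j, Fin.natAdd n' j) = C (t j))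
    (hoff : ∀ j j', j ≠ j' → j' ≠ j₁ → g (Fin.natAdd n' j, Fin.natAdd n' j') = 0) :
    MvPolynomial.aeval g (perPoly (Fin (n' + s)) ℂ) = C (∏ j, t j) * perPoly (Fin n') ℂ := by
  have hsub : (Matrix.of fun i j => g (i, j)).submatrix finSumFinEquiv finSumFinEquiv =
      Matrix.fromBlocks (Matrix.mvPolynomialX (Fin n') (Fin n') ℂ)
        (Matrix.of fun k j => g (Fin.castAdd s k, Fin.natAdd n' j)) 0
        (Matrix.of fun j j' => g (Fin.natAdd n' j, Fin.natAdd n' j')) := by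
    ext (k | j) (l | j')
    · simp [h₁₁]
    · simp
    · simp [h₂₁]
    · simp
  have hD : (Matrix.of fun j j' => g (Fin.natAdd n' j, Fin.natAdd n' j')).permanent = C (∏ j, t j) := by
    rw [permanent_eq_prod_diag_of_offDiag_col _ j₁ (fun j j' hjj' hj' => by
      simpa using hoff j j' hjj' hj')]
    simp [hdiag, map_prod]
  rw [aeval_perPoly_eq_permanent, ← Matrix.permanent_submatrix_equiv finSumFinEquiv, hsub,
    Matrix.permanent_fromBlocks_zero₂₁, hD, mul_comm, perPoly]

/-- **Absorbing sacrifice, row form** (transpose twin): free block kept, free rows × sacrificed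
columns killed, sacrificed rows × free columns ARBITRARY, sacrificed block = diagonal constants plus
arbitrary entries in the single row `i₁`: `aeval g per_{n'+s} = C (∏ t) · per_{n'}`.
[cite: LandsbergRessayre2017, §6] -/
theorem aeval_perPoly_absorbing_row (i₁ : Fin s)
    (h₁₁ : ∀ k l, g (Fin.castAdd s k, Fin.castAdd s l) = X (k, l))
    (h₁₂ : ∀ k j, g (Fin.castAdd s k, Fin.natAdd n' j) = 0)
    (hdiag : ∀ j, g (Fin.natAdd n' j, Fin.natAdd n' j) = C (t j))
    (hoff : ∀ j j', j ≠ j' → j ≠ i₁ → g (Fin.natAdd n' j, Fin.natAdd n' j') = 0) :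
    MvPolynomial.aeval g (perPoly (Fin (n' + s)) ℂ) = C (∏ j, t j) * perPoly (Fin n') ℂ := by
  have hsub : (Matrix.of fun i j => g (i, j)).submatrix finSumFinEquiv finSumFinEquiv =
      Matrix.fromBlocks (Matrix.mvPolynomialX (Fin n') (Fin n') ℂ) 0
        (Matrix.of fun j l => g (Fin.natAdd n' j, Fin.castAdd s l))
        (Matrix.of fun j j' => g (Fin.natAdd n' j, Fin.natAdd n' j')) := by
    ext (k | j) (l | j')
    · simp [h₁₁]
    · simp [h₁₂]
    · simp
    · simp
  have hD : (Matrix.of fun j j' => g (Fin.natAdd n' j, Fin.natAdd n' j')).permanent = C (∏ j, t j) := by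
    rw [permanent_eq_prod_diag_of_offDiag_row _ i₁ (fun j j' hjj' hj => by
      simpa using hoff j j' hjj' hj)]
    simp [hdiag, map_prod]
  have hT : ∀ (A : Matrix (Fin n') (Fin n') (MvPolynomial (Fin n' × Fin n') ℂ))
      (Cb : Matrix (Fin s) (Fin n') (MvPolynomial (Fin n' × Fin n') ℂ))
      (D : Matrix (Fin s) (Fin s) (MvPolynomial (Fin n' × Fin n') ℂ)),
      (Matrix.fromBlocks A 0 Cb D).permanent = A.permanent * D.permanent := by
    intro A Cb D
    rw [← Matrix.permanent_transpose, Matrix.fromBlocks_transpose, Matrix.transpose_zero,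
      Matrix.permanent_fromBlocks_zero₂₁, Matrix.permanent_transpose, Matrix.permanent_transpose]
  rw [aeval_perPoly_eq_permanent, ← Matrix.permanent_submatrix_equiv finSumFinEquiv, hsub, hT, hD,
    mul_comm, perPoly]

/-- **Absorbing sacrifice, diagonal form** (no pin inside the sacrificed block; the free rows ×
sacrificed columns block may still be arbitrary): `aeval g per_{n'+s} = C (∏ t) · per_{n'}`.  With
`t = 1` and that block zero this is the floor's `FreeSubtorusSubtorusCovering.stub_substPer`.
[cite: LandsbergRessayre2017, §6] -/
theorem aeval_perPoly_absorbing_diag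
    (h₁₁ : ∀ k l, g (Fin.castAdd s k, Fin.castAdd s l) = X (k, l))
    (h₂₁ : ∀ j l, g (Fin.natAdd n' j, Fin.castAdd s l) = 0)
    (hD : ∀ j j', g (Fin.natAdd n' j, Fin.natAdd n' j') = if j = j' then C (t j) else 0) :
    MvPolynomial.aeval g (perPoly (Fin (n' + s)) ℂ) = C (∏ j, t j) * perPoly (Fin n') ℂ := by
  have hsub : (Matrix.of fun i j => g (i, j)).submatrix finSumFinEquiv finSumFinEquiv =
      Matrix.fromBlocks (Matrix.mvPolynomialX (Fin n') (Fin n') ℂ)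
        (Matrix.of fun k j => g (Fin.castAdd s k, Fin.natAdd n' j)) 0
        (Matrix.diagonal fun j => C (t j)) := by
    ext (k | j) (l | j')
    · simp [h₁₁]
    · simp
    · simp [h₂₁]
    · simp [hD, Matrix.diagonal_apply]
  rw [aeval_perPoly_eq_permanent, ← Matrix.permanent_submatrix_equiv finSumFinEquiv, hsub,
    Matrix.permanent_fromBlocks_zero₂₁, Matrix.permanent_diagonal, ← map_prod, mul_comm, perPoly]

end Sacrifice

/-! ### The cofactor under a pinned substitution -/

section Cofactor

/-- Substituting constants: `aeval (C ∘ c) q = C (eval c q)`. [folklore] -/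
private theorem aeval_C_comp {σ τ : Type*} {R : Type*} [CommSemiring R] (c : σ → R)
    (q : MvPolynomial σ R) : aeval (fun p => (C (c p) : MvPolynomial τ R)) q = C (eval c q) := by
  induction q using MvPolynomial.induction_on with
  | C a => simp only [aeval_C, algebraMap_eq, eval_C]
  | add p q hp hq => simp only [map_add, hp, hq]
  | mul_X p i hp => simp only [map_mul, hp, aeval_X, eval_X]

/-- A polynomial all of whose variables are sent to constants is sent to a constant:
if `g p = C (c p)` for every `p ∈ q.vars` then `aeval g q = C (eval c q)`. [folklore] -/
theorem aeval_eq_C_eval_of_vars {σ τ : Type*} {R : Type*} [CommSemiring R] (q : MvPolynomial σ R)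
    (g : σ → MvPolynomial τ R) (c : σ → R) (h : ∀ p ∈ q.vars, g p = C (c p)) :
    aeval g q = C (eval c q) := by
  rw [← aeval_C_comp c q]
  change eval₂Hom _ g q = eval₂Hom _ _ q
  exact eval₂Hom_congr' rfl (fun p hp _ => h p hp) rfl

/-- **A generic pin makes a linear form non-zero.**  If `q` is a linear form with
`coeff x_{p₀} q ≠ 0`, then for every assignment `c` one of the two NON-ZERO pin values `u₀ ∈ {1, 2}`
at `p₀` gives `eval (c[p₀ ↦ u₀]) q ≠ 0` (the value is affine in `u₀` with slope `coeff x_{p₀} q`).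
[folklore] -/
theorem exists_pin_eval_ne_zero {σ : Type*} [Fintype σ] [DecidableEq σ] (q : MvPolynomial σ ℂ)
    (hq : q.IsHomogeneous 1) (p₀ : σ) (hp₀ : coeff (Finsupp.single p₀ 1) q ≠ 0) (c : σ → ℂ) :
    ∃ u₀ : ℂ, u₀ ≠ 0 ∧ eval (Function.update c p₀ u₀) q ≠ 0 := by
  -- `eval (c[p₀ ↦ u]) q - eval (c[p₀ ↦ u']) q = coeff x_{p₀} q · (u - u')`
  have hlin : ∀ u u' : ℂ, eval (Function.update c p₀ u) q - eval (Function.update c p₀ u') q =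
      coeff (Finsupp.single p₀ 1) q * (u - u') := by
    intro u u'
    conv_lhs => rw [Theorems.SchenstedIndex.eq_sum_coeff_single_mul_X hq]
    simp only [map_sum, map_mul, eval_C, eval_X, ← Finset.sum_sub_distrib, ← mul_sub]
    rw [Finset.sum_eq_single p₀]
    · simp
    · intro p _ hp
      simp [Function.update_of_ne hp]
    · exact fun h => absurd (Finset.mem_univ _) h
  by_cases h1 : eval (Function.update c p₀ 1) q = 0
  · refine ⟨2, two_ne_zero, fun h2 => hp₀ ?_⟩
    have h := hlin 2 1
    rw [h1, h2, sub_zero] at h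
    have h' : coeff (Finsupp.single p₀ 1) q * (2 - 1) = 0 := h.symm
    rwa [show (2 : ℂ) - 1 = 1 by norm_num, mul_one] at h'
  · exact ⟨1, one_ne_zero, h1⟩

/-- **The pinned substitution sends the cofactor to a non-zero constant.**  If `q` is a linear
form, the substitution `g` sends every variable of `q` to a constant (`g p = C (c p)` on `q.vars`:
all of `supp q` lies in killed positions or on the sacrificed diagonal), and `p₀ ∈ supp q`
(`coeff x_{p₀} q ≠ 0`), then re-pinning `p₀` to a suitable NON-ZERO constant `u₀` gives
`aeval (g[p₀ ↦ C u₀]) q = C κ` with `κ ≠ 0`. [folklore] -/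
theorem exists_pin_aeval_eq_C_ne_zero {σ τ : Type*} [Fintype σ] [DecidableEq σ]
    (q : MvPolynomial σ ℂ) (hq : q.IsHomogeneous 1) (g : σ → MvPolynomial τ ℂ) (c : σ → ℂ)
    (h : ∀ p ∈ q.vars, g p = C (c p)) (p₀ : σ) (hp₀ : coeff (Finsupp.single p₀ 1) q ≠ 0) :
    ∃ u₀ κ : ℂ, u₀ ≠ 0 ∧ κ ≠ 0 ∧ aeval (Function.update g p₀ (C u₀)) q = C κ := by
  obtain ⟨u₀, hu₀, hne⟩ := exists_pin_eval_ne_zero q hq p₀ hp₀ c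
  refine ⟨u₀, eval (Function.update c p₀ u₀) q, hu₀, hne, ?_⟩
  refine aeval_eq_C_eval_of_vars q _ _ fun p hp => ?_
  by_cases hpp : p = p₀
  · subst hpp
    simp
  · rw [Function.update_of_ne hpp, Function.update_of_ne hpp, h p hp]

end Cofactor

end Summit.ValiantsHypothesis.ValiantsHypothesis.Theorems.FreeSubtorusOrbitDimensionBound.AbsorbingSacrifice

end
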